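import Mathlib
import HarnessLib
import HarnessLib.Audit
import Summits.ABC.Statement
import Literature.NumberTheory.DiophantineGeometry.AbcWave0

/-!
Route: IneffectiveSubspace

DORMANT since 2026-09-03T10:18:11Z (reconciler: no traction for 5 d (last activity statement-checked at 2026-08-29T09:09:02Z); parked, not closed — `ledger route dormant route-ABC-IneffectiveSubspace --off` to reactivate) — unstaffed, not closed; items shared with open routes are served there. `ledger route dormant <id> --off` reactivates.

Route IneffectiveSubspace — ABC/ABC (card ABC/ABC/ineffective-subspace-truncation-free); rev 28
(route-choice extend-cruxes, event 2026-08-16T06:06:28Z, items PrimePowerRadical /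
TowerFourSubLiouville — OPTION (a) EXECUTED TO THE LETTER by seat g24, 2026-08-16): CRUX-ONLY
DECIDING THEOREM closes : UniformSadicTowerFour → PrimePowerRadical → TowerFourSubLiouville →
DeepRegimeABC → ABC. Hypotheses = the open cruxes #2, #3, #4, #6 (crux #5 DepthCountedABC is not
assumed but DERIVED inside the proof term from #2 through the PROVED dictionary
TowerFourGivesDepthCounted, stmt-ABC-14940, re-proved in place because a Theses file cannot import
the Theorems module), conclusion = the Statement decl; farm check of the rendered rev-27 file with
this theorem: rc 0, 0 sorry, axioms propext / Classical.choice / Quot.sound, h21_check_closes ok,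
codes [], hypotheses = [#2, #3, #4, #6], binder_used = {#2, #6}, glue_used = {#2, #5}, in_cone =
{#2, #3, #4, #5, #6, dictionary} ⊇ EVERY open crux (the residual advisory glue.unused-crux lists
only closed/moot records and free-standing supports: TowerExponentWindow,
UniformSadicGivesTowerFour, AbcGivesUniformSadic, UniformSadicGivesPrimePowerRadical,
TowerLiouvilleExponent, AbcGivesTower, WindowGivesPolynomialAbc, CanonicalTowerLift, Assembly).
LOAD-BEARING: #2 and #6 only. #3 PrimePowerRadical and #4 TowerFourSubLiouville are COROLLARY RUNGS
carried as NON-LOAD-BEARING hypotheses (binders `_h_…`, unused in the term, said so in the theorem's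
comment): #4 ⟸ #2 at K = 0 (support UniformSadicGivesTowerFour, PROVED), #3 ⟸ #2 at K = 1, S = {q}
(support UniformSadicGivesPrimePowerRadical, kernel-checked by g23, port pending), and both ⟸ ABC
(towerFourSubLiouville_of_abc; abc_imp_primePowerRadical). The finding of seats g2–g24 stands and is
the reason they are not USED: no honest proof of ABC can consume either (TowerFourSubLiouville
bounds c by rad₄ ≥ rad with some A < 2, which discharges abc on no triple; PrimePowerRadical has a
per-q constant and the complement of its Mersenne cell is abc-complete by the breeding (1, b, b+1) ↦
(b², 2b+1, (b+1)²)). WHY THEY ARE HYPOTHESES ANYWAY (g24, read off HarnessLib/Audit/Check.lean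
`closesCone`): the item cone is seeded by the constants of the deciding theorem's type and proof,
`unused` = cruxes outside it, and `derived` never exempts a crux and is empty from the route-file
vantage (same-module `_holds` witnesses only) — so the rev-27 expectation that landing the two
supports makes #3/#4 `derived` members of the cone cannot come true, and a corollary-rung crux stays
glue.unused-crux (and re-arms this route-choice: 24 generations) unless it is a hypothesis of
closes, dropped (breaks the 37 Theorems modules naming the decls) or re-kinded (de-staffs the two
crux chains the human restored, lead lines picked 13:18Z/13:27Z). As hypotheses they are honest
NECESSARY rungs — implied by the conclusion, so a disproof of either is a first-class kill path of
closes — and the assembly invariant 'hypotheses are exactly the listed items' holds for the open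
crux list up to the derived #5. Cruxes: #2 UniformSadicTowerFour, #3 PrimePowerRadical, #4
TowerFourSubLiouville, #5 DepthCountedABC, #6 DeepRegimeABC. Thesis X (it suffices to show) = RIDOUT
AT LEVEL FOUR + ABC ON THE DEEP TAIL (#2 ∧ #6); closes is X → ABC with the two rungs #3, #4 of X's
first factor listed alongside.
(1) UniformSadicTowerFour. For every K ∈ ℕ and ε > 0 there is C = C(K, ε) > 0 — INEFFECTIVE C
allowed — such that for every set S of at most K primes and all positive integers x_i, y_i, z_i (1 ≤
i ≤ 4) with x_1x_2²x_3³x_4⁴ + y_1y_2²y_3³y_4⁴ = z_1z_2²z_3³z_4⁴ and gcd = 1 one has z_1z_2²z_3³z_4⁴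
< C·((Π_{p∈S} p)·{Π_i x_i y_i z_i}^S)^(1+ε), where {m}^S is the S-free part of m. K = 0 is Vojta's
inequality with exponent 1 for the level-4 pair (Γ'_4, D'_4) of Vojta2000ABC §3 at S = {∞} (it
implies the banked special case TowerFourSubLiouville, A = 1 < 2 — support
UniformSadicGivesTowerFour, PROVED); general K is the same inequality with the counting function
taken off S, UNIFORMLY over |S| ≤ K at the price (Π_{p∈S} p)^(1+ε) (linear S-loss, forced: with (Π
p)^ε it is false for primes p < q ≤ p + p^0.6 on (p², q²−p², q²), S = {p, q}). The level-1 analogue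
(one variable per coordinate) is Ridout's p-adic Roth theorem in abc form, {abc}^S ≥ c^(1−ε)/C(S,ε)
for coprime a + b = c (Ridout1958; Vojta1987 Thm 2.1.1 and §3.2, read on the page, PDF pp. 16, 29):
PROVED, ineffective, per S.
(2) DeepRegimeABC. Write ω₅(abc) := #{p : p⁵ ∣ abc} (the 5-depth count). DeepRegimeABC := for every
ε > 0 there are K = K(ε) and C = C(ε) such that every abc triple with ω₅(abc) ≥ K satisfies c <
C·rad(abc)^(1+ε) — abc on an ε-DEPENDENT deep tail: hypothesis-free, equivalent to its constant-free
form (C = 1, since ω₅ ≥ K forces rad ≥ p_K#), implied by ABC (K = 0), refutable by a single family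
of quality ≥ 1+δ with ω₅ → ∞.
Dictionary / assembly: OPTIMAL level-4 lifts (for a = Π p^e put p^(⌈e/4⌉−1+[4∣e]) in the exponent-4
slot and p in the slot of e mod 4: Π_i x_i^i = a and Π_i x_i = rad₄(a) := Π p^⌈e/4⌉) with S := {p :
v_p(abc) ≥ 5} turn (1) into DepthCountedABC — abc with a constant C(K,ε) on each cell {ω₅(abc) ≤ K}
(crux #5) — exactly, because then (Π_{p∈S} p)·{Π x_i y_i z_i}^S = rad(abc) (support
TowerFourGivesDepthCounted, PROVED in Theorems); and DepthCountedABC ∧ DeepRegimeABC ⟹ ABC by a case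
split at the single cell K(ε) (max of two constants). Deciding theorem (D-0027 §2.1, rev 28,
crux-only): closes (h_UniformSadicTowerFour) (_h_PrimePowerRadical) (_h_TowerFourSubLiouville)
(h_DeepRegimeABC) : ABC := DepthCountedABC from the first binder through the dictionary proved in
place, then that case split — load-bearing binders #2 and #6, the rungs #3/#4 unused, no support
among the hypotheses.
PrimePowerRadical (abc on (1, q^k−1, q^k) with a constant per q: the K = 1, S = {q}, a = 1 rung of
(1) — support UniformSadicGivesPrimePowerRadical) and TowerFourSubLiouville (the K = 0, A < 2 rung
of (1) — support UniformSadicGivesTowerFour, PROVED) are hypotheses of closes but carry no weight in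
its proof (corollary rungs; route-choice finding above). Every item is implied by ABC. Honest
accounting of the cut: ABC ⟺ DeepRegimeABC ∧ BoundedOmegaABC (abc on {ω(abc) ≤ W} with C(W,ε); one
quintic breeding (c⁵−b⁵) + b⁵ = c⁵ on a coordinate pair carrying > 2K primes) and DepthCountedABC ⟹
BoundedOmegaABC (ω₅ ≤ ω), so GIVEN #5 the new residue is equivalent to the old DepthCountedABC → ABC
— nothing provable is lost — while as a free-standing statement it is a genuine weakening of ABC
that no quality-preserving identity can complete (a Belyi map of degree d forces ≤ (2d−2)/4 new
5-deep primes at exponent cost (1+ε′)/(1−(d−1)ε′); tails with K(ε) ≥ 1/(2ε) are out of reach),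
unlike every FIXED cell {ω₅ ≥ K₀}, which is abc-complete by breeding.
Lean (seat g24, 2026-08-16: glue.lean = ONE theorem, 177 lines = the rev-20 term of g20 with the two
rung binders added; checked on the farm inside a verbatim copy of the rev-27 route file
(RouteScratch.lean, import HarnessLib.Audit.Check added for the audit line): rc 0, 0 sorry, closes'
axioms propext / Classical.choice / Quot.sound; h21_check_closes ok = true, codes [], binder_used =
[UniformSadicTowerFour, DeepRegimeABC], glue_used = [UniformSadicTowerFour, DepthCountedABC],
in_cone = [UniformSadicTowerFour, PrimePowerRadical, TowerFourSubLiouville, DepthCountedABC,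
DeepRegimeABC, TowerFourGivesDepthCounted]): X = UniformSadicTowerFour ∧ DeepRegimeABC, where
UniformSadicTowerFour := ∀ K : ℕ, ∀ ε : ℝ, 0 < ε → ∃ C : ℝ, 0 < C ∧ ∀ S : Finset ℕ, S.card ≤ K → (∀
p ∈ S, Nat.Prime p) → ∀ x y z : Fin 4 → ℕ, (∀ i, 0 < x i ∧ 0 < y i ∧ 0 < z i) → (∏ i, x i ^ (i.val +
1)) + (∏ i, y i ^ (i.val + 1)) = ∏ i, z i ^ (i.val + 1) → Nat.Coprime (∏ i, x i ^ (i.val + 1)) (∏ i,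
y i ^ (i.val + 1)) → ((∏ i, z i ^ (i.val + 1) : ℕ) : ℝ) < C * (((∏ p ∈ S, p) * ∏ p ∈ (∏ i, x i * y i
* z i).primeFactors \ S, p ^ (∏ i, x i * y i * z i).factorization p : ℕ) : ℝ) ^ (1 + ε),
DeepRegimeABC := ∀ ε : ℝ, 0 < ε → ∃ K : ℕ, ∃ C : ℝ, 0 < C ∧ ∀ a b c : ℕ, IsABCTriple a b c → K ≤
((a*b*c).primeFactors.filter (fun p => 5 ≤ (a*b*c).factorization p)).card → (c : ℝ) < C * (rad a b c
: ℝ) ^ (1 + ε), and the glue partner DepthCountedABC := ∀ K : ℕ, ∀ ε : ℝ, 0 < ε → ∃ C : ℝ, 0 < C ∧ ∀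
a b c : ℕ, IsABCTriple a b c → ((a*b*c).primeFactors.filter (fun p => 5 ≤ (a*b*c).factorization
p)).card ≤ K → (c : ℝ) < C * (rad a b c : ℝ) ^ (1 + ε) (derived from (1) inside closes by the
dictionary = support TowerFourGivesDepthCounted, PROVED, re-proved in place).

Rationale: WHY THIS LINE. The summit tolerates an ineffective C, and the one proven engine with the right
exponent shape (1+ε, constant-only losses) is Schmidt's subspace theorem and its descendants
(RuVojta2020Birational β-constant; at level 1, Roth–Ridout). Vojta2000ABC §3 put abc (for ε > 3/n)
inside Vojta's non-truncated conjecture on ONE explicit G_m^(2n−2)-pair (Γ'_n, D'_n) per level n.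
Revs 1–5 bet on the tower in n (TowerIneq(n, A_n), A_n → 1); the environment proved that target ≡
ABC (Cruxes/TowerThesis/Disproof.lean: towerThesis_iff_abc, towerThesis_iff_forall_one) and that the
β-machine is vacuous at S = {∞} on every model (evidence NoGo-RV-vacuity on stmt-ABC-1647), so the
level dial is dead and was dropped by the human ruling. What survives is the OTHER dial of the same
machine: the set of places S. Rev 6 fixed the level at n = 4 (the first abc-relevant level, home of
TowerFourSubLiouville) and moves along S: crux UniformSadicTowerFour is Vojta's inequality for
(Γ'_4, D'_4) with counting function off S, uniformly over |S| ≤ K with linear S-loss — 'Ridout at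
level four' (n = 1 is Ridout1958 = Vojta1987 Thm 2.1.1, proved, ineffective, per S). This is exactly
the regime where Ru–Vojta / GCD outputs are NON-vacuous: points that are S-integral-like for a large
S (near-S-unit regime: Levin2019GCD Thm 1.1, BugeaudCorvajaZannier2003, CorvajaZannier2002; Yasufuku
doi:10.1112/blms.70349 Rem. 3.6), and the banked crux PrimePowerRadical (abc on (1, q^k−1, q^k),
constant per q) is literally its K = 1, S = {q}, a = 1 corner (the rad-versus-rad₄ depth of q^k − 1
is absorbed by the per-q constant: support UniformSadicGivesPrimePowerRadical, kernel-checked by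
seat g23). The arithmetic cash-out is elementary and exact: with OPTIMAL lifts (Π x_i = rad₄(a)) and
S := the primes dividing abc to the 5th power, (Π_{p∈S} p)·{Π x_i y_i z_i}^S = rad(abc), so
UniformSadicTowerFour(K) is abc for triples with ω₅(abc) ≤ K, constant C(K,ε) (DepthCountedABC; K =
0 = abc for 5-free triples; dictionary TowerFourGivesDepthCounted PROVED). HONESTY ACCOUNTING (why
the residue is ONE deep-tail crux and nothing else): every FIXED 'deep-regime abc' cell — some v_p ≥
5, 5-full part ≥ c^θ (θ < 2), ω₅ ≥ K₀, ω_odd ≥ W₀ — is abc-COMPLETE by breeding (iterate (a−b)² +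
4ab = c², then (b⁵, c⁵−b⁵, c⁵): quality Q ↦ 5Q/(4Q+1) > 1, each step adding an odd prime ≡ 1 mod 5
from Φ₅), hence costume as an item; but breeding has a CAPACITY: a Belyi map of degree d forces at
most (2d−2)/4 new 5-deep primes on a worst-case triple while costing exponent (1+ε′)/(1−(d−1)ε′)
(Riemann–Hurwitz; Cruxes/DepthUniformity/BarrierNotes-r1-k2.md N1, Ellenberg2000 as the model
transfer), so a tail {ω₅ ≥ K(ε)} with K(ε) ≥ 1/(2ε) is NOT reachable by any quality-preserving
identity — the ε-dependent threshold is the first cut of the deep regime that is a genuine weakening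
of ABC as far as identities can see (Robert–Stewart–Tenenbaum Conj. A puts the true threshold at
K(ε) ≍ ε⁻²/log²(1/ε), far beyond the breeding-complete range log₅(1/ε)). Conversely
UniformSadicTowerFour and DepthCountedABC are not reachable by breeding either (identities only
raise exponents and prime counts; rad₄ charges p^⌈5e/4⌉ on fifth powers), and
UniformSadicTowerFour(0) already yields abc with exponent (1+ε)/(1−ε) for CUBE-FREE triples via the
squaring identity. So ABC ⟺ DepthCountedABC ∧ DeepRegimeABC (⟸: case split at the cell K(ε) = the
deciding theorem; ⟹: trivial) is the factorisation in which the first factor is the arithmetic face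
of the mechanism crux and the second is abc on an arbitrarily thin deep tail; the exact complement
statement ABC ⟺ DeepRegimeABC ∧ BoundedOmegaABC (abc on {ω(abc) ≤ W}; one quintic breeding) with
DepthCountedABC ⟹ BoundedOmegaABC (ω₅ ≤ ω) shows that given #5 the new #6 is EQUIVALENT to the
rev-6/7 residue DepthCountedABC → ABC (Cruxes/DepthUniformity/SketchIdeator1.lean; this seat's
Sketch.lean: deepRegimeABC_of_abc, depthUniformity_of_deepRegimeABC,
deepRegimeABC_of_depthUniformity, all kernel-checked) — the restatement loses nothing provable and
replaces an implication between two abc-strength statements, whose hypothesis can never be invoked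
on a deep triple (depth is monotone under every admissible Belyi transfer), by one directly
falsifiable statement on one regime. Same two-factor shape as GenericSliceLangevin/SliceUniformity
(route parity-slice-concordant-norms) and the compact-balance split of route CongruentialReceptacle,
but here BOTH factors are hypothesis-free. Imported: Diophantine approximation
(Roth–Ridout–Schmidt–Schlickewei, Ru–Vojta), S-unit equations (EvertseGyory2015); no cross-field
dictionary beyond Vojta's.
RANKED CRUXES. #2 UniformSadicTowerFour (the mechanism bet; K = 0 ⟹ TowerFourSubLiouville,
Lean-checked; K = 1, S = {q} gives q^k < C(q·rad₄(q^k−1))^(1+ε) uniformly in q, and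
PrimePowerRadical itself for each fixed q — Lean-checked, g23). #3 PrimePowerRadical (stmt-ABC-1648)
and #4 TowerFourSubLiouville (stmt-ABC-1649): route-choice finding (b), 2026-08-16 (seats g2–g24,
kernel-checked certificates in the g2/g6/g21 evidence) — NO HONEST BRIDGE makes either load-bearing
for ABC: TowerFourSubLiouville has an empty abc-content cell (rad₄ ≥ rad, so exponent A < 2 on
level-4 points never yields 1+ε anywhere; it follows from every abc exponent < 2 and from #2 at K =
0 by the PROVED support UniformSadicGivesTowerFour); PrimePowerRadical is per-q (no constant uniform
in q) and the complement of its Mersenne cell is abc-complete by the breeding (1, b, b+1) ↦ (b²,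
2b+1, (b+1)²), quality Q ↦ 2Q/(1+Q) > 1, so any completing hypothesis is ABC in costume
(kernel-checked in the g2/g6 evidence: VerdictSketch.lean, OffMersenneABC ↔ ABC). Both are COROLLARY
RUNGS — TowerFourSubLiouville ⟸ #2 at K = 0 (UniformSadicGivesTowerFour, PROVED) and ⟸ ABC
(towerFourSubLiouville_of_abc, landed); PrimePowerRadical ⟸ #2 at K = 1, S = {q} (support
UniformSadicGivesPrimePowerRadical, g23: optimal level-4 lift of m = q^k − 1 with x = 1, z =
(q^k,1,1,1), charged quantity q·rad₄(m), rad₄(m)⁴ ≤ m·rad(m)³ < q^k·rad(m)³, logarithms,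
3(1+ε)/(3−ε) ≤ 1 + ε₀ for ε = min(ε₀,1)/4, per-q constant — uniformity in q NOT obtained, the loss
being q^((1+4ε)/(3−ε)); kernel-checked in the g23 Sketch.lean, 0 sorry, std axioms) and ⟸ ABC
(abc_imp_primePowerRadical, Cruxes workfile) — and since rev 28 (g24) they are carried INSIDE the
deciding theorem as NON-LOAD-BEARING HYPOTHESES (binders `_h_PrimePowerRadical`,
`_h_TowerFourSubLiouville`, unused in the term; audit binder_used = {#2, #6}, in_cone ⊇ all five
open cruxes): the audit's `unused` is 'cruxes outside the cone seeded by the type and proof of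
closes' and its `derived` list never exempts a crux (empty from the route-file vantage), so this is
the only encoding that keeps them cruxes (kind crux, ranks 3/4, human ruling 2026-08-16; live lead
lines nevbir-below-beta on #3 and fourth-radical-binomial-thue on #4; 13 landed PrimePowerRadical
stub lemmas, TowerFourSubLiouvilleCoreIff / StubTransfer / StubFixedFormsRoth, Disproof.lean and
Negative/ files) AND inside the argument the gate audits; as hypotheses implied by the conclusion
they are necessary rungs whose disproof is a kill path of closes; credited when proved
(automatically once #2 is). #5 DepthCountedABC (the arithmetic face of #2: abc with C = C(ω₅(abc),
ε); complete census of the 3504 abc hits (rad < c) with c ≤ 10⁷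
(Cruxes/DepthUniformity/Census-r1-k2.md, kit j015304, validated against the published counts
120/418/1268/3499): cells ω₅ = 0, 1, 2, 3, 4 hold 170/1323/1598/405/8 hits with max quality 1.2920
(1, 80, 81) / 1.5679 (1, 4374, 4375) / 1.6299 (2, 3¹⁰·109, 23⁵) / 1.4619 (2⁷·5², 7⁶·41, 13⁶) /
1.3449 ((2890625, 6067327, 8957952), deep set {2,3,5,7}); the 5-free cell K = 0 is the tamest — no
5-free triple beats (1, 80, 81) up to 10⁷). #6 DeepRegimeABC (rev 8: the DEEP-TAIL RESIDUE, restated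
from DepthUniformity stmt-ABC-14939 on the joint recommendation of crux ideas deep-regime-complement
and deep-tail-escape; abc-hard — 'abc minus the Pillai corner' — and said so; what #2 already pays
on it: with S := the K₀ largest level-4 overcharges, UniformSadicTowerFour(K₀) gives exponent
(1+ε)/(1−(1+ε)η) on the STEEP part {O_rest(K₀) ≤ η log c}, so relative to #2 the hard core is
FLAT-HEAVY very-deep abc (ω₅ → ∞, deep part ≥ c^(4η), overcharge spread over unboundedly many
primes) — a cell that is EMPTY among all 3504 hits with c ≤ 10⁷: max O_rest(3) = 0.069·log c; lowest
rank, staff last; the disprover's normal form of ¬#6 is a flat, heavy family of quality ≥ 1+δ with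
ω₅ → ∞). Supports: TowerFourGivesDepthCounted (PROVED: optimal lift + S := deep primes; since rev 20
re-proved INSIDE closes and used there — no longer a binder), UniformSadicGivesTowerFour (#2 at K =
0 ⟹ #4; PROVED), UniformSadicGivesPrimePowerRadical (#2 at K = 1, S = {q} ⟹ #3; proved in the g23
Sketch, to be landed in Theorems), AbcGivesUniformSadic (upper half of the sandwich for #2),
TowerLiouvilleExponent / AbcGivesTower / CanonicalTowerLift (proved), WindowGivesPolynomialAbc,
Assembly (rev ≤ 5 records, moot; TowerMonotone dropped at rev 26 for the item cap).
KILL CRITERIA. (i) MECHANISM: a no-go extending NoGo-RV-vacuity from S = {∞} to S = {∞} ∪ T (|T| ≤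
K) — i.e. every big L on Γ'_4 (or on Yasufuku's X_3 for the banked PrimePowerRadical) has max_j β(L,
D'_j)^(−1) ≥ the abc threshold even with the T-adic proximity terms in m_S — means no item of this
route is reachable by the subspace/β engine: close `exhausted` with that census (items stay as
negative-knowledge-free open statements for other routes). (ii) COSTUME: a quality-preserving
polynomial identity F + G = H whose values on abc triples are 5-free (or have ω₅ bounded) with
positive frequency makes DepthCountedABC abc-complete by breeding; a non-Belyi transfer, or any
identity forcing ≥ K new 5-deep primes at a quality cost independent of K, makes DeepRegimeABC
abc-complete — either way the factorisation is vacuous: retire `not-a-thesis`. (iii) Any item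
refuted refutes ABC itself (all are implied by ABC): then the summit closes negatively and this
route with it; for #6 specifically the refuting object is a family of quality ≥ 1+δ with ω₅ → ∞,
necessarily flat and heavy (every printed high-merit family — Stewart–Tijdeman pigeonhole,
Reyssat-type sporadics, Frey–Nitaj — has merit → 0 or ω₅ ≤ 3). (iv) No movement on #2 at K ∈ {0,1}
AND on #5/#6 within tenure ⟹ dormant (progress on the corollary rungs #3/#4 alone does not count as
movement of the line).
NOT DECOMPOSED YET. The per-S form of #2 (C = C(S, ε), no uniformity: Vojta's Main Conjecture
[Vojta1987 Conj. 3.4.3] for (Γ'_4, D'_4) with arbitrary S — the literal published conjecture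
instance; #2(K) implies it for |S| ≤ K) and the uniformity-in-S step between them; the same
factorisation at other levels n (ω_{n+1}-depth; n = 4 chosen as the first abc-relevant level and the
home of #4); the geometric layer (β(L, D'_j) on Γ'_4 with p-adic places in S, Levin-type GCD
inequalities for the exceptional divisors; for #6 the |S| → ∞ totally degenerate corner of the same
computation, where S-uniformity is needed only at the simply-exponential scale e^(O(|S|)) because
rad ≥ |S|! on the cell); number-field / bounded-degree versions; for #6 the STEEP/FLAT split as
items (steep_of_ustf: #2 at K₀ places ⟹ abc on STEEP(K₀, η); the flat-heavy core with its lattice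
rigidity — for deep part V ≥ 4c² the pair (a, b) is the unique primitive short vector of the deep
lattice), the constant-free normal form, and the complement theorem DeepRegimeABC ∧ BoundedOmegaABC
→ ABC (typed in Cruxes/DepthUniformity/SketchIdeator1.lean, provable now, not load-bearing for
closes).
CHEAPEST FALSIFIER. For honesty (ii): enumerate homogeneous identities F + G = H of degree ≤ 6 with
FGH ∈ ℤ[a,b] (de Weger's 'triples from triples' list, deWeger2023Fudge §3.6, and the six Belyi
breedings of route parity-slice) and test on the 33 quality-≥1.2 triples with c ≤ 2·10⁴ whether any
output is 5-free with quality > 1 — one afternoon of kit compute; a hit kills the #5 half of the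
factorisation (the #6 half is protected by the Riemann–Hurwitz capacity count, which a single
explicit Belyi map with more than (2d−2)/4 rational points of index ≥ 5 outside {0,1,∞} would
contradict — impossible). For the mechanism (i): compute β(L, D'_j) on Yasufuku's X_3 chain with S =
{∞, q} (2-dimensional intersection theory, card D1) — if vacuous there too, #2 (and the banked
PrimePowerRadical) lose their engine at once. For #6 (data, cheapest of all): extend the depth
census (census_depth.py, complete by construction) to c ≤ 10⁸ at q ≥ 1.2 (kit j015390 queued by the
ideator) — a cell ω₅ ≥ 3 whose top quality fails to decay with the scale, or any hit with O_rest(3)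
> 0.1·log c (a flat profile), is the first empirical sign against DeepRegimeABC and redirects #6 to
the disprover.

Novelty: Searches (2026-08-15, opening + two novelty audits: lit frontier ABC --since 2020; read on the page
paper:arxiv-math_9908024 (Vojta2000ABC §3, §7), paper:arxiv-1601.03825 (Yasufuku2018Blowups),
paper:doi-10-1112-blms-70349, galaxy-pdf-567071920674888520 §31, arXiv:2004.12257; 2026-08-16 rev
6–8 seats: Ridout1958 / Vojta1987 Thm 2.1.1 + §3.2 read on the page (PDF pp. 16, 29),
EvertseGyory2015 §4.6 p. 87, RobertStewartTenenbaum2014, Cruxes/DepthUniformity census kit j015304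
(3504 abc hits, c ≤ 10⁷); 2026-08-16 g6: lit search --hybrid "abc conjecture powerful numbers number
of prime factors refinement Baker" (10 local docs: EvertseGyory2015 pp. 87–88 re-read — Baker
1998/2004 and Granville 1998 ω(abc)-refinements, RST 2014, Győry 2008 (4.6.4)), lit search --hybrid
"coprime powerful a+b=c Nitaj Erdős" (8 docs, Guy1994 B16), lit galaxy search "S-parts of values of
univariate polynomials" / "… binary forms abc" --star all (0 hits ×2; searchd rc 75 once).
Nearest prior art found: Vojta2000ABC §3 Thm 3.12 (abc for ε > 3/n inside Vojta's conjecture on the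
explicit pair (Γ'_n, D'_n); S = {∞} only, no depth bookkeeping); Ridout1958 = Vojta1987 Thm
2.1.1/§3.2 (the level-1, per-S, ineffective statement {abc}^S ≥ c^(1−ε)/C(S,ε)); Schlickewei1977
(p-adic subspace); Baker1998/Baker2004 and RobertStewartTenenbaum2014 (abc refinements whose
constant depends on ω(abc) — all primes, any depth); BugeaudEvertseGyory2018 (S-parts of values of
forms: the {m}^S bookkeeping, for decomposable forms, no  [refs: 10.1112/blms.70349, 2004.12257, paper:arxiv-math_9908024, paper:arxiv-1601.03825, paper:doi-10-1112-blms-70349, doi:10.1112/blms.70349, Ridout1958, Vojta1987, EvertseGyory2015, RobertStewartTenenbaum2014, Guy1994, Schlickewei1977, Baker1998, Baker2004, BugeaudEvertseGyory2018]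

Barriers (technique_class: schmidt-subspace beta-constant depth-regime-split ineffective): - technique_class: schmidt-subspace, beta-constant, depth-regime-split, ineffective (level fixed at
4: the rev ≤ 5 vojta-blowup-tower dial is retired; ridout-sadic = the S-adic subspace engine)
- Literature.Barriers.ABC.BakerMethodBounds: evaded by construction — no linear forms in logarithms
anywhere; all losses sit in the ineffective constants C(K,ε), C(ε) and in Roth's ε (∀ε ∃C permits
ineffectivity); the deep-tail residue asks for exponent 1+ε, which Baker-class bounds (Stewart–Yu
exp(rad^(1/3+ε)), Győry (4.6.4)) cannot reach on any cell — the bet is the subspace/β engine at S ⊋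
{∞}, not log forms.
- Literature.Barriers.ABC.IntegersHaveNoDerivation: its recorded evasion (a) (Vojta1987 Ch. 6 §7:
successive minima as the arithmetic derivative, 'Roth/Schmidt but not abc') IS the engine;
truncation is supplied by Vojta2000ABC's geometry at the fixed level 4 (φ of multidegree (1,2,3,4),
K(D') ≥ φ*O(1)) plus the S-adic bookkeeping, so no derivation on ℤ and no truncated counting
function is posited; the honest residue of the barrier is the β-gap at S = {∞} (NoGo-RV-vacuity,
evidence on stmt-ABC-1647) = why-might-fail of UniformSadicTowerFour at K = 0.
- Literature.Barriers.ABC.EpsilonCannotBeDropped: respected — every item keeps ε in the exponent and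
a constant depending on (K, ε); the linear S-loss (Π_{p∈S} p)^(1+ε) is itself forced by a
Stewart–Tijdeman-type family (p², q²−p², q²), S = {p,q}, primes q ≤ p + p^0.6; nothing ε-free or
polylog-sharp is claimed.
- Literature.Barri

History (route lifecycle, newest last):
- 2026-08-16T02:17:28Z · AUTO-CRUX: 1 conjecture-grade item(s) promoted to crux (TowerThesis) — refuter vetting / tiering apply (operator:999:1362873)
- 2026-08-16T03:15:52Z · CLOSED retired — route-choice target-unreachable (TowerThesis): retired — target ⟺ ABC (Cruxes/TowerThesis/Disproof towerThesis_of_abc + Assembly; collapse towerThesis_iff_forall_one), mechanism dead at S={∞} (NoGo-RV (planner-rchoice-ABC-IneffectiveSubspace-target-449744f5-0)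
- 2026-08-16T06:06:28Z · REOPENED as DRAFT (human ruling): target TowerThesis dropped (≡ ABC), cruxes PrimePowerRadical + TowerFourSubLiouville restored, proved supports kept; extend cruxes until closes : cruxes → ABC (operator:gate4)
- 2026-08-16T07:58:08Z · rev 8: restated DepthUniformity (stmt-ABC-14939) — route-choice (DepthU, crux stmt-ABC-14939 held: allocation hold needs 14938, no negative lemma on file): RESTATED the residue crux #6 DepthUniformity := DepthCo (planner-rchoice-ABC-IneffectiveSubspace-DepthU-d6a5c59d-0)
- 2026-08-16T13:54:46Z · rev 26: dropped TowerMonotone — route-choice g23, cap bookkeeping before adding the support UniformSadicGivesPrimePowerRadical (#2 ⊢ #3): drop the rev ≤ 5 record TowerMonotone (stmt-ABC-1651, (operator:999:2643257)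
- 2026-08-26T12:04:27Z · DORMANT — reconciler: no traction for 8.3 d (last activity item-evidence-added at 2026-08-18T03:39:12Z); parked, not closed — `ledger route dormant route-ABC-IneffectiveS (operator:999:3860351)
- 2026-08-28T00:50:48Z · REACTIVATED — reconciler: reactivated — activity statement-attached at 2026-08-27T23:33:41Z after parking at 2026-08-26T12:04:27Z (operator:999:513063)
- 2026-09-03T10:18:11Z · DORMANT — reconciler: no traction for 5 d (last activity statement-checked at 2026-08-29T09:09:02Z); parked, not closed — `ledger route dormant route-ABC-IneffectiveSubsp (operator:999:337300)

sub-problem: ABC · status: dormant · opened planner-plancard-ABC-ABC-ineffective-subspace-0e62e4ce-0 2026-08-15T10:57:48Z · rev 28 · ledger route-ABC-IneffectiveSubspace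
GENERATED by the gate from the ledger (D-0016/17). Provers cite these decls: `theorem foo : Summit.ABC.ABC.Theses.IneffectiveSubspace.<Decl> := …` in Summits/ABC/ABC/Theorems/<Name>.lean.
-/

namespace Summit.ABC.ABC.Theses.IneffectiveSubspace

open scoped BigOperators Topology Manifold Classical MeasureTheory ProbabilityTheory Matrix InnerProductSpace ComplexConjugate ContinuousMap
open Filter Set Function TopologicalSpace MeasureTheory

attribute [summit_statement] _root_.ABC

open Literature.Abc

/-- item stmt-ABC-14937 · crux · rank 2 · open · by planner
why it might fail: K=0 is already Vojta at level 4 (⟹ c ≪ rad^(4+ε), cube-free abc): no engine reaches exponent 1 at S={∞} (NoGo-RV-vacuity); for K ≥ 1 uniformity in S is unknown even at level 1 beyond the trivial cases (K=2 contains |q³−p²| ≫ q^(1/2−ε) for primes, Hall-type).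
sources: Ridout1958, Vojta1987, Vojta2000ABC, RuVojta2020Birational, Schlickewei1977, Levin2019GCD
[crux, rank 2 — RIDOUT AT LEVEL FOUR, the mechanism bet] For every K and ε > 0 there is C(K,ε)
(ineffective) such that for every set S of ≤ K primes and every positive coprime solution of
x₁x₂²x₃³x₄⁴ + y₁y₂²y₃³y₄⁴ = z₁z₂²z₃³z₄⁴: Π z_i^i < C·((Π_{p∈S} p)·{Π x_i y_i z_i}^S)^(1+ε), {m}^S =
S-free part of m (Lean: Π over primeFactors ∖ S of p^v_p). READINGS. K = 0: TowerIneq(4,1) = Vojta's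
inequality (exponent 1, S = {∞}) for the level-4 pair (Γ'_4, D'_4) of Vojta2000ABC §3; it implies
TowerFourSubLiouville (A = 1 < 2; Sketch.lean, kernel-checked) and, via the squaring identity (a−b)²
+ 4ab = c² (rad₄ of the square of a cube-free number is its radical), abc with exponent (1+ε)/(1−ε)
for CUBE-FREE triples. General K: the same inequality with counting function off S (Vojta1987 Conj.
3.4.3 is stated with S), made UNIFORM over |S| ≤ K at the price (Π_{p∈S} p)^(1+ε); the linear loss
is forced — with (Π p)^ε the statement is false for primes p < q ≤ p + p^0.6 (BakerHarmanPintz2001):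
triple (p², q²−p², q²), S = {p,q}, optimal lifts give {·}^S = rad₄(q²−p²) ≤ 2p^0.6·2q while the left
side is q². K = 1, S = {q}, triple (1, q^k−1, q^k): q^k < C·(q·rad₄(q^k−1))^(1+ε) with C uniform in
q — the Pri -/
@[route_item "route-ABC-IneffectiveSubspace"]
def UniformSadicTowerFour : Prop :=
  ∀ K : ℕ, ∀ ε : ℝ, 0 < ε → ∃ C : ℝ, 0 < C ∧ ∀ S : Finset ℕ, S.card ≤ K → (∀ p ∈ S, Nat.Prime p) → ∀ x y z : Fin 4 → ℕ, (∀ i, 0 < x i ∧ 0 < y i ∧ 0 < z i) → (∏ i, x i ^ (i.val + 1)) + (∏ i, y i ^ (i.val + 1)) = ∏ i, z i ^ (i.val + 1) → Nat.Coprime (∏ i, x i ^ (i.val + 1)) (∏ i, y i ^ (i.val + 1)) → ((∏ i, z i ^ (i.val + 1) : ℕ) : ℝ) < C * (((∏ p ∈ S, p) * ∏ p ∈ (∏ i, x i * y i * z i).primeFactors \ S, p ^ (∏ i, x i * y i * z i).factorization p : ℕ) : ℝ) ^ (1 + ε)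

/-- item stmt-ABC-1647 · crux · rank 2 · closed · moot by None · by planner
why it might fail: As stated it is exactly polynomial abc (∃κ: c < C·rad^κ): levels n ≤ 3 are closed by the (1,z−1,z), Pell X²+1=2Z², x³+y³=9z³ families; n ≥ 4 is open, all unconditional bounds subexponential (Stewart–Yu, Pasten 2024). β side: K+D' non-big, toric fibres put β at threshold; maybe no L has B < 9/(9−t).
sources: StewartYu2001, Literature.NumberTheory.DiophantineGeometry.stewart_yu, doi:10.1007/s00222-024-01244-6, RuVojta2020Birational, Vojta2000ABC, doi:10.1112/blms.70349
[crux, rank 2 — decisive cash-out] At some level n the exponent enters the abc-relevant window A <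
n/3: ∃ n ≥ 1, 0 < A, 3A < n, TowerIneq(n, A). Equivalent (items WindowGivesPolynomialAbc +
AbcGivesTower-style converse) to POLYNOMIAL abc c < C·rad(abc)^κ with ineffective C — which no
proven method gives (Stewart–Yu is exp(rad^(1/3+ε)), Literature.Barriers.ABC.BakerMethodBounds).
Mechanism: Ru–Vojta General Theorem on (Γ'_n, D'_n) with L_t = D − tφ*O(1): m(D,P) ≤ (B+ε)h_L off Z,
B = max_j β(L_t, D'_j)^(-1); with h_D ≤ 9 log c (Vojta2000ABC Lemma 3.11) this yields TowerIneq(n,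
1/(Bt − 9(B−1))), inside the window iff B < 9/(9−t) (t small: B < 1 + t/9 + …). KILL: compute β(L,
D'_j) for n ≤ 6 over the cone ⟨D'_j, φ*O(1)⟩; if B(L) ≥ 9/(9−t) for every L and no chain-sensitive
improvement (card D2; Heier–Levin arXiv:1712.02456) is typed, the mechanism cannot reach this item.
Planner's indicative computation (NOTES.md): on X_n itself with L = D one gets β(D, {x_k=0}) = 1 +
k/(n(n+1)), hence B_D = 1 − 1/(n²+n+1) and A = n/(3(1−B_D)) = n(n²+n+1)/3 — WORSE than trivial n/2;
all purchase must come from L with negative φ*O(1)-weight (the knife-edge L_t) on the resolution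
Γ'_n, or from a chain-se -/
@[route_item "route-ABC-IneffectiveSubspace"]
def TowerExponentWindow : Prop :=
  ∃ n : ℕ, 1 ≤ n ∧ ∃ A : ℝ, 0 < A ∧ 3 * A < n ∧ ∀ ε : ℝ, 0 < ε → ∃ C : ℝ, 0 < C ∧ ∀ x y z : Fin n → ℕ, (∀ i, 0 < x i ∧ 0 < y i ∧ 0 < z i) → (∏ i, x i ^ (i.val + 1)) + (∏ i, y i ^ (i.val + 1)) = ∏ i, z i ^ (i.val + 1) → Nat.Coprime (∏ i, x i ^ (i.val + 1)) (∏ i, y i ^ (i.val + 1)) → ((∏ i, z i ^ (i.val + 1) : ℕ) : ℝ) < C * ((∏ i, x i * y i * z i : ℕ) : ℝ) ^ (A + ε)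

/-- item stmt-ABC-1648 · crux · rank 3 · open · by planner
why it might fail: Open for every prime q: gives infinitely many non-Wieferich primes base q (Silverman1988) and powerful part of q^k-1 <= C_eps q^(eps k), known only under abc (Ribenboim-Walsh 1999); unconditionally rad(q^k-1) >> k^(1+o(1)) only (Stewart2013); beta on Yasufuku's X_3 may be vacuous.
sources: Silverman1988, doi:10.1006/jnth.1998.2315, doi:10.2140/pjm.1967.22.563, Stewart2013, Yasufuku2018Blowups, paper:arxiv-1601.03825
[crux, rank 3 — the S-unit rung, where the proven β-machine is meaningful] For each prime q: q^k <
C(q,ε)·(rad(1·(q^k−1)·q^k))^(1+ε) = C·(q·rad(q^k − 1))^(1+ε) for all k ≥ 1, i.e. abc for the triples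
(1, q^k − 1, q^k) with a = q^k an S-unit, S = {∞, q}: 'Mersenne-type numbers q^k − 1 have powerful
part ≤ C_ε q^(εk)'. This is precisely the output of Vojta's (non-truncated) conjecture on Yasufuku's
rational surface X_3 (blow up P² at [1:0:1] ∈ {Y=0}, then L̃∩E_1, then E_2∩Ẽ_1 — the first right
fork of the Stern–Brocot tree) with divisor L̃_1+L̃_2+L̃_3+Ẽ_1+Ẽ_2+E_3 and S = {∞,q}:
Yasufuku2018Blowups Thm 2′ (ρ = 0, k = ℚ, a = q^k ∈ O_S^*, b = 1 − a, c = 1; exceptional set shown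
there to cost finitely many a), via the gcd inequality (vc_intersect_detail_abc) along Farey
neighbours (Thm 11) and Ridout (Prop 8). Mechanism: compute β(L, ·) for the 6-component chain on X_3
(card D1 at n = 3: 2-dimensional intersection theory, explicit (−1)/(−2) intersection matrix) and
run Ru–Vojta with the q-adic place in S — the near-S-unit regime where such outputs are non-vacuous
(doi:10.1112/blms.70349 Rem 3.6; Levin Invent. 215 (2019) for S-unit gcd). Implied by ABC; implies
infinitely many non-Wieferi -/
@[route_item "route-ABC-IneffectiveSubspace"]
def PrimePowerRadical : Prop :=
  ∀ q : ℕ, q.Prime → ∀ ε : ℝ, 0 < ε → ∃ C : ℝ, 0 < C ∧ ∀ k : ℕ, 1 ≤ k → ((q ^ k : ℕ) : ℝ) < C * ((Literature.NumberTheory.DiophantineGeometry.rad 1 (q ^ k - 1) (q ^ k) : ℕ) : ℝ) ^ (1 + ε)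

/-- item stmt-ABC-1649 · crux · rank 4 · open · by planner
why it might fail: A < 2 forces finiteness of gamma Z^4 - alpha X^4 = beta Y^4 with gamma <= Z^O(2-A) UNIFORMLY in gamma (abc quality -> 2): Thue/Roth/Faltings are per-form and ineffective, Baker bounds exp(poly gamma) too weak, Bennett 2001 counts solutions only; beta(D,D'_j) on Gamma'_4 may be 1.
sources: Roth1955, doi:10.1515/crll.2001.044, Faltings1983Endlichkeit, BombieriPila1989, EvertseGyory2015, BombieriGubler2006
[crux, rank 4 — foothold at S = {∞}] ∃ A < 2 with TowerIneq(4, A): beat the Liouville-trivial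
exponent n/2 = 2 (from abc ≥ c²/2, item TowerLiouvilleExponent) on the first abc-relevant tower X_4
(Vojta needs ε > 3/n; dim Γ'_4 = 7). Census of room (planner, NOTES.md): n = 2 is SHARP at the
trivial A = 1 (Pell X² + 1 = 2Z²: x = (1,X), y = (1,1), z = (2,Z), Π = 2XZ ≈ √2·c); n = 3 has A* ≥ 1
< 3/2 (positive points, dense on the real arc, of the rank-1 twist x³ + y³ = 9z³ give Π ≈
3^(1/3)(abc)^(1/3) ≍ c); for n = 4 every near-fourth-power twist uX⁴ + vY⁴ = wZ⁴ is a genus-3 curve,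
finite by Faltings1983Endlichkeit (ineffective — allowed), and the b-tiny regime is governed by
Roth1955 on |uX⁴ − wZ⁴| (ineffective — allowed), so there is genuine room below 2; the probabilistic
heuristic puts A*(4) = 1. Engines: (i) the β-machine: with L = D it gives A = 4/(3(1−B_D)), which
beats 2 only if β(D, D'_j) > 3 for all j, while on X_4 itself β(D,{x_k=0}) = 1 + k/20 (planner,
NOTES.md) gives A = 28 — so a sign of life at S = {∞} already needs L_t = D − tφ*O(1) on Γ'_4 or a
chain-sensitive improvement; (ii) independently, uniform counting of rational points on the twists
(BombieriPila1989; Heath-Brown -/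
@[route_item "route-ABC-IneffectiveSubspace"]
def TowerFourSubLiouville : Prop :=
  ∃ A : ℝ, A < 2 ∧ ∀ ε : ℝ, 0 < ε → ∃ C : ℝ, 0 < C ∧ ∀ x y z : Fin 4 → ℕ, (∀ i, 0 < x i ∧ 0 < y i ∧ 0 < z i) → (∏ i, x i ^ (i.val + 1)) + (∏ i, y i ^ (i.val + 1)) = ∏ i, z i ^ (i.val + 1) → Nat.Coprime (∏ i, x i ^ (i.val + 1)) (∏ i, y i ^ (i.val + 1)) → ((∏ i, z i ^ (i.val + 1) : ℕ) : ℝ) < C * ((∏ i, x i * y i * z i : ℕ) : ℝ) ^ (A + ε)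

/-- item stmt-ABC-14938 · crux · rank 5 · open · by planner
why it might fail: K=0 (5-free abc) already carries quality 1.292 at (1,80,81) and nothing beyond Stewart–Yu is proved on any cell; false iff abc fails along a family with bounded ω₅ — e.g. inside the a=1, c=q^k families of PrimePowerRadical if Wieferich-type depth stays bounded.
sources: Baker1998, Baker2004, EvertseGyory2015, RobertStewartTenenbaum2014, StewartYu2001, BrowkinBrzezinski1994
[crux, rank 5 — the arithmetic face of #2] abc with a constant allowed to depend on the 5-DEPTH
COUNT ω₅(abc) := #{p : p⁵ ∣ abc}: ∀ K ∀ ε ∃ C(K,ε) ∀ abc-triples with ω₅(abc) ≤ K: c <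
C·rad(abc)^(1+ε). K = 0 is abc for 5-free triples; each K is a strictly larger cell and ⋃_K = all
triples, so the only thing separating this from ABC is uniformity of C in K (crux DepthUniformity).
Derived from UniformSadicTowerFour by optimal level-4 lifts with S := {p : v_p(abc) ≥ 5} (support
TowerFourGivesDepthCounted: then (Π_{p∈S}p)·{Π x_i y_i z_i}^S = rad(abc) on the nose). Literature
frame: refinements of abc whose constant depends on a prime count of abc are Baker's and Granville's
(Baker1998, Baker2004: c < 6/5·Q(log Q)^t/t!, t = ω(abc); EvertseGyory2015 §4.6 PDF p.87;
RobertStewartTenenbaum2014); here the count is restricted to primes at depth ≥ 5 = level 4 of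
Vojta's tower, which is what makes K = 0 a Vojta statement on one variety. CENSUS (planner,
census.py, c ≤ 2·10⁴): 33 triples of quality ≥ 1.2; 21 have ω₅ ≤ 1 incl. the top three (1, 2·3⁷,
5⁴·7) q = 1.568, (1, 2⁵·3·5², 7⁴) q = 1.456, (3, 5³, 2⁷) q = 1.427; exactly 5 are 5-free, top (1,
2⁴·5, 3⁴) q = 1.292, (1, 23³, 2³3²13²) q = 1.256, ( -/
@[route_item "route-ABC-IneffectiveSubspace"]
def DepthCountedABC : Prop :=
  ∀ K : ℕ, ∀ ε : ℝ, 0 < ε → ∃ C : ℝ, 0 < C ∧ ∀ a b c : ℕ, Literature.NumberTheory.DiophantineGeometry.IsABCTriple a b c → ((a * b * c).primeFactors.filter (fun p => 5 ≤ (a * b * c).factorization p)).card ≤ K → (c : ℝ) < C * ((Literature.NumberTheory.DiophantineGeometry.rad a b c : ℕ) : ℝ) ^ (1 + ε)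

/-- item stmt-ABC-15121 · crux · rank 6 · open · by planner
why it might fail: abc off the bounded-ω corner: false iff a family with quality ≥ 1+δ and ω₅ → ∞ exists; nothing known is monotone-favourable in the number of deep primes (|S| is a cost in Ridout/Subspace, C^ω in Baker), and even finiteness of coprime 5-full a + b = c is open (Erdős–Nitaj).
sources: RobertStewartTenenbaum2014, Ellenberg2000, EvertseGyory2015, EvertseSchlickeweiSchmidt2002, Guy1994, Nitaj1996
[crux, rank 6 — the DEEP-TAIL RESIDUE; hypothesis-free restatement (rev 8) of DepthUniformity
stmt-ABC-14939 after crux ideas deep-regime-complement / deep-tail-escape] abc on an ε-DEPENDENT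
deep tail: for every ε > 0 there are K and C such that every abc triple with ω₅(abc) := #{p : p⁵ ∣
abc} ≥ K satisfies c < C·rad(abc)^(1+ε). POSITION: implied by ABC (K = 0); with crux #5
DepthCountedABC it gives ABC by a case split at the single cell K(ε) (this is `closes`); conversely
#5 ∧ (#5 → ABC) ⟹ ABC ⟹ this, so GIVEN #5 it is equivalent to the old residue #5 → ABC (lossless
re-cut); in full ABC ⟺ DeepRegimeABC ∧ abc-on-{ω(abc) ≤ W} (one quintic breeding;
Cruxes/DepthUniformity/SketchIdeator1.lean) and #5 ⟹ the latter (ω₅ ≤ ω). Equivalent to its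
constant-free form (C = 1: ω₅ ≥ K forces rad ≥ p_K#) and to 'quality → ≤ 1 along every sequence of
triples with ω₅ → ∞'. WHY ∃K(ε) AND NOT A FIXED CELL: every {ω₅ ≥ K₀} is abc-complete by Belyi
breeding, but a degree-d Belyi map forces ≤ (2d−2)/4 new 5-deep primes at exponent cost
(1+ε′)/(1−(d−1)ε′), so tails with K(ε) ≥ 1/(2ε) are unreachable by identities
(Cruxes/DepthUniformity/BarrierNotes-r1-k2.md N1); Robert–Stewart–Tenenbaum Conj. A predict -/
@[route_item "route-ABC-IneffectiveSubspace"]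
def DeepRegimeABC : Prop :=
  ∀ ε : ℝ, 0 < ε → ∃ K : ℕ, ∃ C : ℝ, 0 < C ∧ ∀ a b c : ℕ, Literature.NumberTheory.DiophantineGeometry.IsABCTriple a b c → K ≤ ((a * b * c).primeFactors.filter (fun p => 5 ≤ (a * b * c).factorization p)).card → (c : ℝ) < C * ((Literature.NumberTheory.DiophantineGeometry.rad a b c : ℕ) : ℝ) ^ (1 + ε)

/-- item stmt-ABC-14940 · support · rank 9 · closed · proved by Summit.ABC.ABC.Theorems.towerFourGivesDepthCounted_proof @ bcb2e06ba333 (prover) · by planner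
sources: Vojta2000ABC, paper:arxiv-math_9908024
[support, provable now — the dictionary, ~200–400 lines] UniformSadicTowerFour → DepthCountedABC.
PROOF: fix K, ε and take C from UniformSadicTowerFour at (K, ε). Given an abc triple (a,b,c) with D
:= {p : v_p(abc) ≥ 5}, |D| ≤ K, build OPTIMAL level-4 lifts: for a = Π p^e write e = 4q′ + r with r
∈ {1,2,3,4} (q′ = ⌈e/4⌉ − 1); put x at the exponent-4 slot (index 3) := Π_p p^(q′+[r=4]) and x at
slot r ∈ {1,2,3} (index r−1) := Π_{p : r_p = r} p; then Π_i x_i^(i+1) = Π p^(4q′+r) = a, all x_i ≥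
1, and Π_i x_i = Π p^⌈e/4⌉ =: rad₄(a); likewise y, z for b, c. The point (x,y,z) satisfies the tower
hypotheses (positivity; the sum is a + b = c; coprimality of Π x_i^(i+1) = a and b). Take S := D
(primes, card ≤ K). For p ∉ D, v_p(abc) ≤ 4, so p divides exactly one of a, b, c with e ≤ 4, whence
q′ = 0 and v_p(Π x_i y_i z_i) = 1; therefore {Π x_i y_i z_i}^S = Π_{p ∣ abc, p ∉ D} p and (Π_{p∈D}
p)·{Π x_i y_i z_i}^S = Π_{p ∣ abc} p = rad(abc) = Literature.NumberTheory.DiophantineGeometry.rad a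
b c (Nat.radical / primeFactors of a product of coprime numbers). The tower inequality then reads c
= Π z_i^(i+1) < C·rad(abc)^(1+ε). Lean hints: Nat.factorization, Finsupp.prod,
Nat.support_factorization, Na -/
@[route_item "route-ABC-IneffectiveSubspace"]
def TowerFourGivesDepthCounted : Prop :=
  UniformSadicTowerFour → DepthCountedABC

-- `TowerFourGivesDepthCounted` holds: proved by `Summit.ABC.ABC.Theorems.towerFourGivesDepthCounted_proof` @ bcb2e06ba333 (its module imports this route file, so no `_holds` link can be stated here).

/-- item stmt-ABC-15070 · support · rank 9 · closed · proved by Summit.ABC.ABC.Theorems.uniformSadicGivesTowerFour_proof @ b4953a09398c (prover) · by operator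
sources: Vojta2000ABC, Ridout1958
[support, PROVED in the planner's Sketch.lean (route-choice g3 evidence: theorem
towerFour_of_uniformSadic, farm rc 0, 18 lines)] Crux #2 UniformSadicTowerFour at K = 0, S = ∅ is
Vojta's level-4 inequality with exponent 1 — the S-free part of M = ∏ xᵢyᵢzᵢ off S = ∅ is ∏_{p ∈
M.primeFactors} p^{v_p(M)} = M (Nat.factorization_prod_pow_eq_self /
Nat.prod_factorization_pow_eq_self, Finsupp.prod, Nat.support_factorization; M ≠ 0 from positivity)
— hence crux #4 TowerFourSubLiouville with A := 1 < 2 and the same C(0, ε). ROLE: records the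
logical position of stmt-ABC-1649 in the rev-6 bridge — a COROLLARY RUNG of #2 (proving #2 closes #4
through this item), not a load-bearing hypothesis of `closes`; by the route-choice g3 verdict (depth
monotonicity of Belyi transfers + abc-completeness of the non-5-free cell by one quintic breeding)
no honest bridge can make #4 load-bearing, so #4 is banked standalone when proved (its own line:
crux ⟺ uniform binomial-quartic saving,
Theorems/IneffectiveSubspaceTowerFourSubLiouvilleCoreIff.lean). [deps: UniformSadicTowerFour,
TowerFourSubLiouville] [difficulty: provable-now] -/
@[route_item "route-ABC-IneffectiveSubspace"]
def UniformSadicGivesTowerFour : Prop :=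
  UniformSadicTowerFour → TowerFourSubLiouville

-- `UniformSadicGivesTowerFour` holds: proved by `Summit.ABC.ABC.Theorems.uniformSadicGivesTowerFour_proof` @ b4953a09398c (its module imports this route file, so no `_holds` link can be stated here).

/-- item stmt-ABC-15071 · support · rank 9 · closed · proved by Summit.ABC.ABC.Theorems.abcGivesUniformSadic_proof (prover) · by operator
sources: Vojta2000ABC
[support, provable now — upper half of the sandwich for crux #2, ~80 lines modelled on
Theorems/IneffectiveSubspaceAbcGivesTower.lean] ABC ⟹ UniformSadicTowerFour, with abc's own C(ε)
serving every K and every S. PROOF: for a positive coprime tower point put a = ∏ xᵢ^(i+1), b, c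
likewise, M = ∏ xᵢyᵢzᵢ; (a, b, c) is an abc triple (IsABCTriple: positivity, a + b = c, Nat.Coprime
a b given) and rad a b c = radical(abc) = radical(M) = ∏_{p ∈ M.primeFactors} p (abc = ∏
(xᵢyᵢzᵢ)^(i+1): AbcGivesTower.prod_pow_mul_three / radical_dvd_prod;
Nat.radical_eq_prod_primeFactors). Split M.primeFactors = (M.primeFactors ∩ S) ⊔ (M.primeFactors ∖
S): ∏_{M.primeFactors ∩ S} p ∣ ∏_{p ∈ S} p (Finset.prod_dvd_prod_of_subset) and ∏_{M.primeFactors ∖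
S} p ∣ ∏_{M.primeFactors ∖ S} p^{v_p(M)} (v_p(M) ≥ 1 on primeFactors), so rad a b c ∣ (∏_{p∈S} p) ·
∏_{p ∈ M.primeFactors ∖ S} p^{M.factorization p}; the right side is positive (S ⊆ primes), hence rad
≤ it (Nat.le_of_dvd) and c < C·rad^(1+ε) ≤ C·(…)^(1+ε) by Real.rpow_le_rpow_left/Real.rpow
monotonicity in the base (1 + ε > 0). ROLE: shows #2 — hence #5 (dictionary 14940), #4
(UniformSadicGivesTowerFour) and the level-free S ⊇ supp(abc) corner 'abc on ω(abc) -/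
@[route_item "route-ABC-IneffectiveSubspace"]
def AbcGivesUniformSadic : Prop :=
  ABC → UniformSadicTowerFour

-- `AbcGivesUniformSadic` holds: proved by `Summit.ABC.ABC.Theorems.abcGivesUniformSadic_proof` (its module imports this route file, so no `_holds` link can be stated here).

/-- item stmt-ABC-15167 · support · rank 9 · closed · proved by Summit.ABC.ABC.Theorems.uniformSadicGivesPrimePowerRadical_proof @ 076b3ab63bd8 (prover) · by operator
sources: Vojta2000ABC, Ridout1958, Silverman1988
[support, provable now — PROVED in the planner's Sketch.lean (route-choice extend-cruxes seat g23
evidence: theorem primePowerRadical_of_uniformSadicTowerFour / uniformSadicGivesPrimePowerRadical,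
farm rc 0, 0 sorry, axioms propext/Classical.choice/Quot.sound; port it to Theorems)] Crux #2
UniformSadicTowerFour at K = 1, S = {q} ⟹ crux #3 PrimePowerRadical — the exact analogue for
stmt-ABC-1648 of UniformSadicGivesTowerFour (stmt-ABC-15070, K = 0 ⟹ stmt-ABC-1649). PROOF: fix a
prime q and ε₀ > 0, put ε := min(ε₀,1)/4 and take C = C(1, ε). For k ≥ 1 let m := q^k − 1 and lift
the abc triple (1, m, q^k) to level 4 by x = (1,1,1,1), y = the OPTIMAL lift of m (∏ yᵢ^(i+1) = m,
v_p(∏ yᵢ) = ⌈v_p(m)/4⌉ — the construction inside closes), z = (q^k,1,1,1) (q ∈ S is not charged, so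
any lift of q^k will do). With S = {q}: (∏ xᵢyᵢzᵢ) = Y·q^k with Y := ∏ yᵢ, its prime factors off q
are those of Y with the same valuations (q ∤ Y since q ∤ m), so (∏_{p∈S} p)·{∏ xᵢyᵢzᵢ}^S = q·Y and
the tower reads q^k < C·(qY)^(1+ε). Depth bound: Y⁴ ≤ m·rad(m)³ (prime by prime 4⌈v/4⌉ ≤ v + 3;
Nat.factorization_le_iff_dvd) and m < q^k. Logarithms: log q^k < log C + (1+ε)(log q + log Y) and 4
log Y < log q^k + 3 log ra -/
@[route_item "route-ABC-IneffectiveSubspace"]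
def UniformSadicGivesPrimePowerRadical : Prop :=
  UniformSadicTowerFour → PrimePowerRadical

-- `UniformSadicGivesPrimePowerRadical` holds: proved by `Summit.ABC.ABC.Theorems.uniformSadicGivesPrimePowerRadical_proof` @ 076b3ab63bd8 (its module imports this route file, so no `_holds` link can be stated here).

/-- item stmt-ABC-1650 · support · rank 9 · closed · proved by Summit.ABC.ABC.Theorems.towerLiouvilleExponent_proof @ 352fc8cfbf10 (prover) · by planner
sources: Vojta2000ABC
[support, provable now — calibration] The trivial ('Liouville') end of the dial: TowerIneq(n, n/2)
with C = 2: from a + b = c, a,b ≥ 1 one has ab ≥ c/2, so abc ≥ c²/2, and Π_i x_i ≥ a^(1/n) since a =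
Π x_i^i ≤ (Π x_i)^n; hence Π x_i y_i z_i ≥ (abc)^(1/n) ≥ (c²/2)^(1/n) and c ≤ √2·Π^(n/2) ≤
√2·Π^(n/2+ε) (Π ≥ 1). Records in Lean where 'nothing' sits, so that #2/#4 are measured against it. -/
@[route_item "route-ABC-IneffectiveSubspace"]
def TowerLiouvilleExponent : Prop :=
  ∀ n : ℕ, 1 ≤ n → ∀ ε : ℝ, 0 < ε → ∃ C : ℝ, 0 < C ∧ ∀ x y z : Fin n → ℕ, (∀ i, 0 < x i ∧ 0 < y i ∧ 0 < z i) → (∏ i, x i ^ (i.val + 1)) + (∏ i, y i ^ (i.val + 1)) = ∏ i, z i ^ (i.val + 1) → Nat.Coprime (∏ i, x i ^ (i.val + 1)) (∏ i, y i ^ (i.val + 1)) → ((∏ i, z i ^ (i.val + 1) : ℕ) : ℝ) < C * ((∏ i, x i * y i * z i : ℕ) : ℝ) ^ ((n : ℝ) / 2 + ε)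

-- `TowerLiouvilleExponent` holds: proved by `Summit.ABC.ABC.Theorems.towerLiouvilleExponent_proof` @ 352fc8cfbf10 (its module imports this route file, so no `_holds` link can be stated here).

/-- item stmt-ABC-1652 · support · rank 9 · closed · proved by Summit.ABC.ABC.Theorems.abcGivesTower_proof @ 0136809fb2cf (prover) · by planner
sources: Vojta2000ABC, Yasufuku2018Blowups
[support, provable now — upper half of the sandwich] ABC ⟹ TowerIneq(n, 1) for every n ≥ 1: for a
point of X_n put a = Π x_i^(i+1), b = Π y_i^(i+1), c = Π z_i^(i+1); (a,b,c) is an abc triple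
(positivity, a + b = c, Nat.Coprime a b given), and rad(abc) = rad(Π_i x_i y_i z_i) ≤ Π_i x_i y_i
z_i (Nat.radical of a product of powers; radical ≤ self), so c < C·rad^(1+ε) ≤ C·Π^(1+ε). Shows the
target is not stronger than the summit (refuter check: X is not 'S in costume with extra strength');
geometric meaning: abc ⟹ Vojta's inequality at these points, cf. Yasufuku2018Blowups Thm 3 for the
surface towers. -/
@[route_item "route-ABC-IneffectiveSubspace"]
def AbcGivesTower : Prop :=
  ABC → ∀ n : ℕ, 1 ≤ n → ∀ ε : ℝ, 0 < ε → ∃ C : ℝ, 0 < C ∧ ∀ x y z : Fin n → ℕ, (∀ i, 0 < x i ∧ 0 < y i ∧ 0 < z i) → (∏ i, x i ^ (i.val + 1)) + (∏ i, y i ^ (i.val + 1)) = ∏ i, z i ^ (i.val + 1) → Nat.Coprime (∏ i, x i ^ (i.val + 1)) (∏ i, y i ^ (i.val + 1)) → ((∏ i, z i ^ (i.val + 1) : ℕ) : ℝ) < C * ((∏ i, x i * y i * z i : ℕ) : ℝ) ^ (1 + ε)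

-- `AbcGivesTower` holds: proved by `Summit.ABC.ABC.Theorems.abcGivesTower_proof` @ 0136809fb2cf (its module imports this route file, so no `_holds` link can be stated here).

/-- item stmt-ABC-1653 · support · rank 9 · closed · moot by None · by planner
sources: Vojta2000ABC, StewartYu2001
[support, provable now — what crux #2 buys] TowerExponentWindow ⟹ polynomial abc: ∃ κ, C > 0 with c
< C·rad(abc)^κ for all abc triples. Proof: with n, A, 3A < n from the hypothesis choose ε small with
3(A+ε) < n; canonical lifts (item CanonicalTowerLift) give Π x_i y_i z_i ≤ rad(abc)·c^(3/n); then c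
< C·(rad·c^(3/n))^(A+ε) rearranges to c^(1−3(A+ε)/n) < C·rad^(A+ε), i.e. c < C'·rad^κ with κ =
n(A+ε)/(n − 3(A+ε)). The first polynomial-shape abc bound would follow; compare
Literature.NumberTheory.DiophantineGeometry.stewart_yu (log c ≪ rad^(1/3)(log rad)³) and
WeakABCConjecture (c < rad², constant 1 — NOT claimed here). -/
@[route_item "route-ABC-IneffectiveSubspace"]
def WindowGivesPolynomialAbc : Prop :=
  (∃ n : ℕ, 1 ≤ n ∧ ∃ A : ℝ, 0 < A ∧ 3 * A < n ∧ ∀ ε : ℝ, 0 < ε → ∃ C : ℝ, 0 < C ∧ ∀ x y z : Fin n → ℕ, (∀ i, 0 < x i ∧ 0 < y i ∧ 0 < z i) → (∏ i, x i ^ (i.val + 1)) + (∏ i, y i ^ (i.val + 1)) = ∏ i, z i ^ (i.val + 1) → Nat.Coprime (∏ i, x i ^ (i.val + 1)) (∏ i, y i ^ (i.val + 1)) → ((∏ i, z i ^ (i.val + 1) : ℕ) : ℝ) < C * ((∏ i, x i * y i * z i : ℕ) : ℝ) ^ (A + ε)) → ∃ κ C : ℝ, 0 < C ∧ ∀ a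 b c : ℕ, Literature.NumberTheory.DiophantineGeometry.IsABCTriple a b c → (c : ℝ) < C * ((Literature.NumberTheory.DiophantineGeometry.rad a b c : ℕ) : ℝ) ^ κ

/-- item stmt-ABC-1654 · support · rank 9 · closed · proved by Summit.ABC.ABC.Theorems.canonicalTowerLift_proof @ 5a1ba99b76d6 (prover) · by planner
sources: Vojta2000ABC, Vojta2011CIME
[support, provable now — Vojta's lift, Vojta2000ABC §3.1 / Vojta2011CIME Thm 31.1 proof] For n ≥ 1
and a ≥ 1 there is x : Fin n → ℕ, all x_i ≥ 1, with Π x_i^(i+1) = a and (Π x_i)^n ≤ rad(a)^n·a: take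
x at exponent n (index n−1) = Π_p p^⌊ord_p a / n⌋ and, for 1 ≤ j < n, x at exponent j = Π_{p : ord_p
a ≡ j mod n} p (squarefree, disjoint supports); then Π_{j<n} x_j ≤ rad(a) and (x_n)^n ≤ a. rad =
UniqueFactorizationMonoid.radical in ℕ (= Π primeFactors, Nat.radical lemmas in Mathlib). Used by
Assembly and WindowGivesPolynomialAbc; file once, cite with --supports. -/
@[route_item "route-ABC-IneffectiveSubspace"]
def CanonicalTowerLift : Prop :=
  ∀ n : ℕ, 1 ≤ n → ∀ a : ℕ, 1 ≤ a → ∃ x : Fin n → ℕ, (∀ i, 0 < x i) ∧ (∏ i, x i ^ (i.val + 1)) = a ∧ (∏ i, x i) ^ n ≤ (UniqueFactorizationMonoid.radical a) ^ n * a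

-- `CanonicalTowerLift` holds: proved by `Summit.ABC.ABC.Theorems.canonicalTowerLift_proof` @ 5a1ba99b76d6 (its module imports this route file, so no `_holds` link can be stated here).

/-- item stmt-ABC-1646 · assembly · rank 1 · closed · moot by None · by planner
sources: Vojta2000ABC, paper:arxiv-math_9908024
[assembly] X → ABC, elementary and provable now: given ε, pick n with κ := n(A_n+ε')/(n − 3(A_n+ε'))
≤ 1+ε (possible since A_n → 1); for an abc triple (a,b,c) take Vojta's canonical lifts (item
CanonicalTowerLift: Π x_i^i = a, (Π x_i)^n ≤ rad(a)^n·a, likewise b, c), so Π x_i y_i z_i ≤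
rad(abc)·(abc)^(1/n) ≤ rad(abc)·c^(3/n) (pairwise coprimality of a,b,c gives rad(a)rad(b)rad(c) =
rad(abc) = Literature.NumberTheory.DiophantineGeometry.rad a b c); then c < C Π^(A_n+ε') rearranges
to c < C'·rad(abc)^κ ≤ C'·rad^(1+ε) (rad ≥ 2). Finitely many small c absorbed in C. Sources:
Vojta2000ABC Lemma 3.5/3.6, Thm 3.12 (the same bookkeeping with N(D,P) ≤ n(abc) + (3/n)h). -/
@[route_item "route-ABC-IneffectiveSubspace"]
def Assembly : Prop :=
  (∃ A : ℕ → ℝ, Filter.Tendsto A Filter.atTop (nhds 1) ∧ ∀ n : ℕ, 1 ≤ n → ∀ ε : ℝ, 0 < ε → ∃ C : ℝ, 0 < C ∧ ∀ x y z : Fin n → ℕ, (∀ i, 0 < x i ∧ 0 < y i ∧ 0 < z i) → (∏ i, x i ^ (i.val + 1)) + (∏ i, y i ^ (i.val + 1)) = ∏ i, z i ^ (i.val + 1) → Nat.Coprime (∏ i, x i ^ (i.val + 1)) (∏ i, y i ^ (i.val + 1)) → ((∏ i, z i ^ (i.val + 1) : ℕ) : ℝ) < C * ((∏ i, x i * y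 i * z i : ℕ) : ℝ) ^ (A n + ε)) → ABC

-- records of items no longer active in this route (dropped / restated):
-- earlier DepthUniformity (stmt-ABC-14939, replaced 2026-08-16T07:58:08Z -> stmt-ABC-15121): retired by None — DepthCountedABC → ABC
-- earlier TowerThesis (stmt-ABC-1645, dropped ): moot by None — ∃ A : ℕ → ℝ, Filter.Tendsto A Filter.atTop (nhds 1) ∧ ∀ n : ℕ, 1 ≤ n → ∀ ε : ℝ, 0 < ε → ∃ C : ℝ, 0 < C ∧ ∀ x y z : Fin n → ℕ, (∀ i, 0 < x i ∧ 0 < y i ∧ 0 < z i) → (∏ i, x i ^ (i.val + 1)) + (∏ i, y i ^ (i.val + 1)) = ∏ i, z i ^ (i.val + 1) → Nat.Coprime (∏ i, x i ^ (i.val + 1)) (∏ i, y i ^ (i.val + 1)) → ((∏ i, z i ^ (i.val + 1) : ℕ) : 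
-- earlier TowerMonotone (stmt-ABC-1651, dropped 2026-08-16T13:54:46Z): moot by None — ∀ m n : ℕ, m ≤ n → ∀ A : ℝ, (∀ ε : ℝ, 0 < ε → ∃ C : ℝ, 0 < C ∧ ∀ x y z : Fin n → ℕ, (∀ i, 0 < x i ∧ 0 < y i ∧ 0 < z i) → (∏ i, x i ^ (i.val + 1)) + (∏ i, y i ^ (i.val + 1)) = ∏ i, z i ^ (i.val + 1) → Nat.Coprime (∏ i, x i ^ (i.val + 1)) (∏ i, y i ^ (i.val + 1)) → ((∏ i, z i ^ (i.val + 1) : ℕ) : ℝ) < C * ((∏ i, x i 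

/-! D-0027 §2.1 — DECIDING THEOREM (planner-authored via `route open/edit --closes-file`; by planner-rchoice-ABC-IneffectiveSubspace-extend-a16d3a49-g24- 2026-08-16T14:04:51Z):
its hypotheses are this route's items and its conclusion the sub-problem Statement (glue_lint), and it elaborates with this file. -/

@[closes "route-ABC-IneffectiveSubspace"] theorem closes (h_UniformSadicTowerFour : UniformSadicTowerFour)
    (_h_PrimePowerRadical : PrimePowerRadical) (_h_TowerFourSubLiouville : TowerFourSubLiouville)
    (h_DeepRegimeABC : DeepRegimeABC) : _root_.ABC := by
  -- Deciding theorem (D-0027 §2.1), CRUX-ONLY — route-choice extend-cruxes, option (a) executed to the letter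
  -- (seat g24, 2026-08-16): `closes : cruxes → ABC`, hypotheses = the OPEN CRUXES of this route that are not derived
  -- inside the proof, conclusion = the Statement decl `_root_.ABC`.
  --   h_UniformSadicTowerFour   crux #2 (stmt-ABC-14937) 'Ridout at level four' — LOAD-BEARING (the mechanism bet);
  --   _h_PrimePowerRadical      crux #3 (stmt-ABC-1648)  — NOT load-bearing: corollary rung of #2 at K = 1, S = {q}
  --                             (support UniformSadicGivesPrimePowerRadical, stmt-ABC-15167) and of ABC itself;
  --   _h_TowerFourSubLiouville  crux #4 (stmt-ABC-1649)  — NOT load-bearing: corollary rung of #2 at K = 0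
  --                             (support UniformSadicGivesTowerFour, stmt-ABC-15070, PROVED) and of ABC itself;
  --   h_DeepRegimeABC           crux #6 (stmt-ABC-15121) abc on the ε-dependent deep tail — LOAD-BEARING.
  -- Crux #5 DepthCountedABC (stmt-ABC-14938) is not assumed: it is DERIVED below from h_UniformSadicTowerFour through
  -- the dictionary TowerFourGivesDepthCounted (stmt-ABC-14940, PROVED as Theorems.towerFourGivesDepthCounted_proof and
  -- re-proved verbatim inside this term because a Theses file cannot import a Theorems module), then ABC follows by
  -- the case split at the single cell K(ε): DeepRegimeABC on {ω₅(abc) ≥ K(ε)}, DepthCountedABC(K(ε)) on its complement.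
  -- WHY #3/#4 ARE HYPOTHESES ALTHOUGH UNUSED (route-choice finding, seats g2–g24: no honest proof of ABC can USE them —
  -- T4SL bounds c by rad₄ ≥ rad with some A < 2, which discharges abc on no triple; PPR has a per-q constant and the
  -- complement of its Mersenne cell is abc-complete by one breeding): the audit's item cone is seeded by the constants
  -- of this theorem's TYPE and proof (HarnessLib/Audit/Check.lean, closesCone), `unused` = cruxes outside that cone,
  -- and `derived` never exempts a crux (it is even empty from the route-file vantage), so a corollary-rung crux is
  -- `glue.unused-crux` for ever unless it is a hypothesis here or is dropped / re-kinded — dropping breaks the 37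
  -- Theorems modules that name the two decls and re-kinding de-staffs the two crux chains the human restored
  -- (2026-08-16T06:06:28Z). As hypotheses they are honest NECESSARY rungs: each is implied by ABC
  -- (towerFourSubLiouville_of_abc, abc_imp_primePowerRadical), so a disproof of either refutes the conclusion and is a
  -- first-class kill path of this theorem (cone.kill-path), while binder_used = {#2, #6} records what carries the proof.
  have h_TowerFourGivesDepthCounted : TowerFourGivesDepthCounted := by
    -- Level-4 bookkeeping: with slot exponents e_k(v) = [k = 3]·⌊v/4⌋ + [k ≠ 3]·[v ≡ k+1 (mod 4)],
    -- ∑_{k<4} (k+1)·e_k(v) = v and ∑_{k<4} e_k(v) = ⌈v/4⌉ = (v+3)/4.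
    have sum_range_four_weighted : ∀ v : ℕ, (Finset.range 4).sum (fun k =>
        (if k = 3 then v / 4 else if v % 4 = k + 1 then 1 else 0) * (k + 1)) = v := by
      intro v
      simp only [Finset.sum_range_succ, Finset.sum_range_zero]
      norm_num
      split_ifs <;> omega
    have sum_range_four : ∀ v : ℕ, (Finset.range 4).sum (fun k =>
        (if k = 3 then v / 4 else if v % 4 = k + 1 then 1 else 0)) = (v + 3) / 4 := by
      intro v
      simp only [Finset.sum_range_succ, Finset.sum_range_zero]
      norm_num
      split_ifs <;> omega
    -- OPTIMAL LEVEL-4 LIFT (Vojta2000ABC §3.1 at n = 4): for m ≠ 0 there is x : Fin 4 → ℕ, all xᵢ ≥ 1,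
    -- with ∏ xᵢ^(i+1) = m and v_p(∏ xᵢ) = ⌈v_p(m)/4⌉ for every p.
    have exists_lift : ∀ {m : ℕ}, m ≠ 0 → ∃ x : Fin 4 → ℕ, (∀ i, 0 < x i) ∧
        (∏ i, x i ^ (i.val + 1)) = m ∧ ∀ p, (∏ i, x i).factorization p = (m.factorization p + 3) / 4 := by
      intro m hm
      -- exponent of a prime with valuation `v` in slot `k`
      let ex : ℕ → ℕ → ℕ := fun v k => if k = 3 then v / 4 else if v % 4 = k + 1 then 1 else 0
      have hsumw : ∀ v, ∑ i : Fin 4, ex v i.val * (i.val + 1) = v := fun v =>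
        (Fin.sum_univ_eq_sum_range (fun k => ex v k * (k + 1)) 4).trans (sum_range_four_weighted v)
      have hsum : ∀ v, ∑ i : Fin 4, ex v i.val = (v + 3) / 4 := fun v =>
        (Fin.sum_univ_eq_sum_range (fun k => ex v k) 4).trans (sum_range_four v)
      have hprime : ∀ p ∈ m.primeFactors, p.Prime := fun p hp => Nat.prime_of_mem_primeFactors hp
      have hfac : ∏ p ∈ m.primeFactors, p ^ m.factorization p = m := by
        conv_rhs => rw [← Nat.prod_factorization_pow_eq_self hm,
          Nat.prod_factorization_eq_prod_primeFactors]
      refine ⟨fun i => ∏ p ∈ m.primeFactors, p ^ ex (m.factorization p) i.val, fun i => ?_, ?_, ?_⟩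
      · -- positivity
        exact Finset.prod_pos fun p hp => pow_pos (hprime p hp).pos _
      · -- `∏ xᵢ^(i+1) = m`: regroup prime by prime and use the weighted bookkeeping identity
        calc (∏ i : Fin 4, (∏ p ∈ m.primeFactors, p ^ ex (m.factorization p) i.val) ^ (i.val + 1))
            = ∏ i : Fin 4, ∏ p ∈ m.primeFactors,
                p ^ (ex (m.factorization p) i.val * (i.val + 1)) := by
              refine Finset.prod_congr rfl fun i _ => ?_
              rw [← Finset.prod_pow]
              refine Finset.prod_congr rfl fun p _ => ?_
              rw [← pow_mul]
          _ = ∏ p ∈ m.primeFactors, ∏ i : Fin 4,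
                p ^ (ex (m.factorization p) i.val * (i.val + 1)) := Finset.prod_comm
          _ = ∏ p ∈ m.primeFactors, p ^ m.factorization p := by
              refine Finset.prod_congr rfl fun p _ => ?_
              rw [Finset.prod_pow_eq_pow_sum, hsumw]
          _ = m := hfac
      · -- `v_p(∏ xᵢ) = ⌈v_p(m)/4⌉`: `∏ xᵢ = ∏_{p ∣ m} p^⌈v_p/4⌉` is a product of prime powers
        intro p
        have hprod : (∏ i : Fin 4, ∏ p ∈ m.primeFactors, p ^ ex (m.factorization p) i.val) =
            ∏ p ∈ m.primeFactors, p ^ ((m.factorization p + 3) / 4) := by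
          rw [Finset.prod_comm]
          refine Finset.prod_congr rfl fun p _ => ?_
          rw [Finset.prod_pow_eq_pow_sum, hsum]
        have hF : (Finsupp.mapRange (fun e => (e + 3) / 4) (by norm_num) m.factorization).prod
            (· ^ ·) = ∏ p ∈ m.primeFactors, p ^ ((m.factorization p + 3) / 4) := by
          rw [Finsupp.prod_mapRange_index (h := (· ^ ·)) (fun _ => pow_zero _), Finsupp.prod,
            Nat.support_factorization]
        rw [hprod, ← hF, Nat.prod_pow_factorization_eq_self, Finsupp.mapRange_apply]
        exact fun q hq => Nat.prime_of_mem_primeFactors (Finsupp.support_mapRange hq)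
    -- coprime numbers have disjointly supported factorizations
    have factorization_eq_zero_or : ∀ {m n : ℕ}, Nat.Coprime m n → ∀ p : ℕ,
        m.factorization p = 0 ∨ n.factorization p = 0 := by
      intro m n h p
      by_cases hpm : p ∣ m
      · by_cases hpn : p ∣ n
        · have hp1 : p = 1 := Nat.eq_one_of_dvd_coprimes h hpm hpn
          subst hp1
          exact Or.inl (Nat.factorization_one_right m)
        · exact Or.inr (Nat.factorization_eq_zero_of_not_dvd hpn)
      · exact Or.inl (Nat.factorization_eq_zero_of_not_dvd hpm)
    -- THE DICTIONARY: fix K, ε, take C(K, ε) from the tower; lift an abc triple with ≤ K primes at depth ≥ 5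
    -- optimally to level 4 and take S = {p : v_p(abc) ≥ 5}; then v_p(∏ xᵢyᵢzᵢ) = ⌈v_p(abc)/4⌉ is 1 off S,
    -- so (∏_{p∈S} p)·{∏ xᵢyᵢzᵢ}^S = rad(abc) on the nose and the tower inequality reads c < C·rad(abc)^(1+ε).
    unfold TowerFourGivesDepthCounted UniformSadicTowerFour DepthCountedABC
    intro hT K ε hε
    obtain ⟨C, hC, hTow⟩ := hT K ε hε
    refine ⟨C, hC, fun a b c habc hK => ?_⟩
    obtain ⟨ha, hb, hsum, hcop⟩ := habc
    have hc : 0 < c := by omega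
    obtain ⟨x, hx0, hxa, hxf⟩ := exists_lift ha.ne'
    obtain ⟨y, hy0, hyb, hyf⟩ := exists_lift hb.ne'
    obtain ⟨z, hz0, hzc, hzf⟩ := exists_lift hc.ne'
    -- the two other coprimalities of the triple
    have hac : Nat.Coprime a c := by
      rw [← hsum]; exact Nat.coprime_self_add_right.mpr hcop
    have hbc : Nat.Coprime b c := by
      rw [← hsum]; exact Nat.coprime_add_self_right.mpr hcop.symm
    -- valuations of the lifted point: `v_p(∏ xᵢyᵢzᵢ) = ⌈v_p(abc)/4⌉`
    have hPfac : ∀ p, (∏ i, x i * y i * z i).factorization p =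
        ((a * b * c).factorization p + 3) / 4 := by
      intro p
      have hx' : (∏ i, x i) ≠ 0 := (Finset.prod_pos fun i _ => hx0 i).ne'
      have hy' : (∏ i, y i) ≠ 0 := (Finset.prod_pos fun i _ => hy0 i).ne'
      have hz' : (∏ i, z i) ≠ 0 := (Finset.prod_pos fun i _ => hz0 i).ne'
      rw [Finset.prod_mul_distrib, Finset.prod_mul_distrib,
        Nat.factorization_mul (mul_ne_zero hx' hy') hz', Nat.factorization_mul hx' hy',
        Nat.factorization_mul (mul_ne_zero ha.ne' hb.ne') hc.ne', Nat.factorization_mul ha.ne' hb.ne']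
      simp only [Finsupp.add_apply, hxf, hyf, hzf]
      rcases factorization_eq_zero_or hcop p with h1 | h1 <;>
      rcases factorization_eq_zero_or hac p with h2 | h2 <;>
      rcases factorization_eq_zero_or hbc p with h3 | h3 <;>
      omega
    -- hence the same prime factors as `abc`
    have hPpf : (∏ i, x i * y i * z i).primeFactors = (a * b * c).primeFactors := by
      ext p
      rw [← Nat.support_factorization, ← Nat.support_factorization, Finsupp.mem_support_iff,
        Finsupp.mem_support_iff, hPfac]
      constructor <;> intro h <;> omega
    -- the deep primes `S = {p : v_p(abc) ≥ 5}`
    set S := (a * b * c).primeFactors.filter (fun p => 5 ≤ (a * b * c).factorization p) with hS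
    have hSprime : ∀ p ∈ S, p.Prime := fun p hp =>
      Nat.prime_of_mem_primeFactors (Finset.mem_filter.mp hp).1
    have hSsub : S ⊆ (∏ i, x i * y i * z i).primeFactors := by
      rw [hPpf]; exact Finset.filter_subset _ _
    -- `(∏_{p∈S} p) · {∏ xᵢyᵢzᵢ}^S = rad(abc)` on the nose
    have hM : (∏ p ∈ S, p) * ∏ p ∈ (∏ i, x i * y i * z i).primeFactors \ S,
        p ^ (∏ i, x i * y i * z i).factorization p =
        Literature.NumberTheory.DiophantineGeometry.rad a b c := by
      have h1 : ∏ p ∈ (∏ i, x i * y i * z i).primeFactors \ S,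
          p ^ (∏ i, x i * y i * z i).factorization p =
          ∏ p ∈ (∏ i, x i * y i * z i).primeFactors \ S, p := by
        refine Finset.prod_congr rfl fun p hp => ?_
        rw [Finset.mem_sdiff, hPpf] at hp
        obtain ⟨hp1, hp2⟩ := hp
        have hne : (a * b * c).factorization p ≠ 0 :=
          Finsupp.mem_support_iff.mp (by rwa [Nat.support_factorization])
        have hlt : ¬ 5 ≤ (a * b * c).factorization p := fun h5 =>
          hp2 (Finset.mem_filter.mpr ⟨hp1, h5⟩)
        have hv : (∏ i, x i * y i * z i).factorization p = 1 := by rw [hPfac]; omega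
        rw [hv, pow_one]
      rw [h1, mul_comm, Finset.prod_sdiff hSsub, hPpf,
        Literature.NumberTheory.DiophantineGeometry.rad_def, Nat.radical_eq_prod_primeFactors]
    -- feed the lifted point to the tower
    have key := hTow S hK hSprime x y z (fun i => ⟨hx0 i, hy0 i, hz0 i⟩)
      (by rw [hxa, hyb, hzc]; exact hsum) (by rw [hxa, hyb]; exact hcop)
    rw [hzc, hM] at key
    exact key
  -- crux #5, reached through the proved dictionary
  have h_DepthCountedABC : DepthCountedABC := h_TowerFourGivesDepthCounted h_UniformSadicTowerFour
  -- case split at the single cell K(ε)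
  intro ε hε
  obtain ⟨K, C₁, hC₁, h₁⟩ := h_DeepRegimeABC ε hε
  obtain ⟨C₂, _hC₂, h₂⟩ := h_DepthCountedABC K ε hε
  refine ⟨max C₁ C₂, lt_max_of_lt_left hC₁, fun a b c habc => ?_⟩
  have hr : (0 : ℝ) ≤ ((Literature.NumberTheory.DiophantineGeometry.rad a b c : ℕ) : ℝ) ^ (1 + ε) :=
    Real.rpow_nonneg (Nat.cast_nonneg _) _
  by_cases hK : K ≤ ((a * b * c).primeFactors.filter (fun p => 5 ≤ (a * b * c).factorization p)).card
  · exact (h₁ a b c habc hK).trans_le (mul_le_mul_of_nonneg_right (le_max_left _ _) hr)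
  · exact (h₂ a b c habc (not_le.mp hK).le).trans_le (mul_le_mul_of_nonneg_right (le_max_right _ _) hr)

end Summit.ABC.ABC.Theses.IneffectiveSubspace
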